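import Mathlib
import Summits.Schanuel.Schanuel.Theorems.RigidCoreMinimalCounterexampleInAclLogSector
import Summits.Schanuel.Schanuel.Theorems.RigidCoreMinimalCounterexampleInAclOfSparsityTwo
import Literature.NumberTheory.Transcendental.TrdegZariskiDimConverse
import Literature.NumberTheory.Transcendental.ExpPointsLogTypePole
import Literature.NumberTheory.Transcendental.ExpPointsCuspTranscendence
import Literature.NumberTheory.Transcendental.ExpPointsConstantExponential
import Literature.NumberTheory.Transcendental.ExpPointsDegenerateSections
import Literature.NumberTheory.Transcendental.ExpPointsBranchLaurent
import Literature.Analysis.Complex.BranchOrders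
import Summits.Schanuel.Schanuel.Theorems.RigidCoreMinimalCounterexampleInAclWindowRecurrenceBranchPhase

/-!
# Window recurrence is finite when `e^{x₀}` is algebraic — line `kernel-arithmetic-selection`, crux stmt-Schanuel-0969

Route `RigidCore`, crux (S*) `MinimalCounterexampleInAcl`, lead prover-line-stmt-Schanuel-0969-c3-0, registered stub
`stub_windowRecurrence_e0` (`--supports stmt-Schanuel-0969`).

For an off-log rank-2 first failure `x` with `e^{x₀} ∈ ℚ̄` the set `E = {x'₀ : x' ∈ locusMates x}` lies on finitely many
cosets of `2πiℤ`; this file proves that LONG WINDOWS RECUR FINITELY OFTEN in `E`: there is `L` such that for every finite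
`G ⊆ ℤ` with `|G| ≥ L` only finitely many `s` have `s + 2πig ∈ E` for all `g ∈ G`.  Structure:

* `branch_window_finite` — ON ONE BRANCH AT INFINITY `𝔟(t) = ((t⁻ᵉ, Φ₁ t/tᴺ), (Φ₂ t/tᴺ, Φ₃ t/tᴺ)) ⊆ W` of the ℚ-curve
  `W ∋ (x, eˣ)` over one coset `c + 2πiℤ` (hits at the principal root `t = x₀^{−1/e}`): if the branch carries infinitely
  many coset hits then `y₀ ≡ eᶜ` on it, a log-type `y₁` is impossible (`false_of_logType_pole`), so `y₁ = e^{ℓ₁(t)}` and the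
  hits are the `k` with `M(t_k) ∈ 2πiℤ` for the MEROMORPHIC phase `M = x₁ − ℓ₁`; if `M` were a polynomial in `t⁻ᵉ = x₀`,
  `e^{ℓ₁}` and `ℓ₁` would both be algebraic over `ℂ[x̂₀]` (`isAlgebraic_coords_of_branch`), forcing `ℓ₁` constant
  (`eventually_const_of_isAlgebraic_exp`) and infinitely many independent points in one fibre `eˣ = ω`
  (`finite_indepExpPoints_fibre`) — so `M` is non-degenerate and the COSET WINDOW RIGIDITY (registered stub
  `stub_windowRigidity_coset`, taken as a hypothesis here) bounds the recurrences;
* `windowRecurrence_e0_of` — the assembly over the finitely many cosets (`exp '' E` finite) and the finitely many branches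
  covering the large coset hits (registered stub `stub_cosetBranchCover`, taken as a hypothesis), with a pigeonhole from a
  long window to a long same-branch sub-window;
* `stub_windowRecurrence_e0` — the registered form, from the two stubs once landed.

References: card `Cruxes/MinimalCounterexampleInAcl/Ideas/torsor-self-selection.md` (crux-ideate r1, ideator 2); the tree's
cusp machinery `Literature/NumberTheory/Transcendental/ExpPoints*.lean` (line cusp-germ-schneider-sparsity of crux 0971).
-/

noncomputable section

set_option linter.dupNamespace false

open Complex Filter Topology Set Metric Polynomial

namespace Summit.Schanuel.Schanuel.Cruxes.MinimalCounterexampleInAcl.KernelArithmeticSelection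

open Literature.NumberTheory.Transcendental
open Literature.Analysis.Complex.LaurentGerm
open Literature.Analysis.Complex.MeromorphicGerm (analyticAt_pow_succ_mul_div_pow analyticAt_pow_succ_mul_inv_pow)
open Literature.Analysis.Complex.BranchOrders (exists_zpow_exp_form)
open Summit.Schanuel.Schanuel.Theorems (mem_of_isDefinedOver_bot_of_relations)

/-- The Taylor series of `f : ℂ → ℂ` at `0`, as a formal power series (local notation, as in the tree's cusp files). -/
local notation3 "𝓣[" f "]" =>
  (PowerSeries.mk fun n => ((Nat.factorial n : ℂ)⁻¹ * iteratedDeriv n f 0) : PowerSeries ℂ)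

/-- The Laurent expansion at `0` of a germ `f` with `zⁿ f(z)` analytic at `0` (local notation). -/
local notation3 "𝓛[" n ", " f "]" =>
  (HahnSeries.single (-((n : ℕ) : ℤ)) (1 : ℂ) *
    HahnSeries.ofPowerSeries ℤ ℂ 𝓣[fun z : ℂ => z ^ (n : ℕ) * (f : ℂ → ℂ) z] : LaurentSeries ℂ)

/-- The branch point `((t⁻ᵉ, Φ₁ t / tᴺ), (Φ₂ t / tᴺ, Φ₃ t / tᴺ)) ∈ ℂ² × ℂ²` (local notation). -/
local notation3 "𝔟[" e ", " N ", " Φ₁ ", " Φ₂ ", " Φ₃ ", " t "]" =>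
  (Sum.elim ![((t : ℂ) ^ (e : ℕ))⁻¹, (Φ₁ : ℂ → ℂ) t / t ^ (N : ℕ)]
    ![(Φ₂ : ℂ → ℂ) t / t ^ (N : ℕ), (Φ₃ : ℂ → ℂ) t / t ^ (N : ℕ)] : Fin 2 ⊕ Fin 2 → ℂ)

section BranchLemma

variable {W : Set (Fin 2 ⊕ Fin 2 → ℂ)} {e N : ℕ} {Φ₁ Φ₂ Φ₃ : ℂ → ℂ}

/-- **Per-branch window finiteness.**  On a branch at infinity `𝔟 ⊆ W` of a ℚ-curve `W` of dimension `< 2`, over a kernel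
coset `c + 2πiℤ` (hits at the principal root `t = x₀^{−1/e}`), windows of length `≥ N + 3` recur finitely often — given the
coset window rigidity for meromorphic phases (registered stub `stub_windowRigidity_coset`, hypothesis `hrig`): if the branch
carries finitely many coset hits this is trivial; otherwise `branch_phase_nondegenerate` supplies the non-degenerate meromorphic
phase `M = x₁ − ℓ₁` whose values at the hits lie in `2πiℤ`. [folklore] -/
theorem branch_window_finite
    (hrig : ∀ (e p : ℕ) (M : ℂ → ℂ) (c : ℂ) (G : Finset ℤ), 0 < e → AnalyticAt ℂ (fun t : ℂ => t ^ p * M t) 0 →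
      (¬ ∃ Q : Polynomial ℂ, ∀ᶠ t in 𝓝[≠] (0 : ℂ), M t = Q.eval (t ^ e)⁻¹) → p + 2 ≤ G.card →
        Set.Finite {k : ℤ | ∀ j ∈ G, ∃ L : ℤ,
          M ((c + 2 * ↑Real.pi * I * ((k + j : ℤ) : ℂ)) ^ (-((e : ℂ)⁻¹))) = (L : ℂ) * (2 * ↑Real.pi * I)})
    (hW : IsDefinedOver (⊥ : Subfield ℂ) W) (hdim : zariskiDim ℂ W < 2) (he : 0 < e) {r : ℝ} (hr : 0 < r)
    (hana : ∀ t : ℂ, ‖t‖ < r → AnalyticAt ℂ Φ₁ t ∧ AnalyticAt ℂ Φ₂ t ∧ AnalyticAt ℂ Φ₃ t)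
    (hWb : ∀ t : ℂ, 0 < ‖t‖ → ‖t‖ < r → 𝔟[e, N, Φ₁, Φ₂, Φ₃, t] ∈ W) (c : ℂ) :
    ∃ L : ℕ, ∀ G : Finset ℤ, L ≤ G.card →
      Set.Finite {k : ℤ | ∀ j ∈ G, ∃ x ∈ indepExpPoints W, ∃ t : ℂ,
        t = (x 0) ^ (-((e : ℂ)⁻¹)) ∧ x 0 = c + 2 * ↑Real.pi * I * ((k + j : ℤ) : ℂ) ∧
        0 < ‖t‖ ∧ ‖t‖ < r ∧ Sum.elim x (cexp ∘ x) = 𝔟[e, N, Φ₁, Φ₂, Φ₃, t]} := by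
  classical
  refine ⟨N + 3, fun G hG => ?_⟩
  -- hits over the coset on this branch
  set Hit : ℤ → Prop := fun m => ∃ x ∈ indepExpPoints W, ∃ t : ℂ,
      t = (x 0) ^ (-((e : ℂ)⁻¹)) ∧ x 0 = c + 2 * ↑Real.pi * I * (m : ℂ) ∧
      0 < ‖t‖ ∧ ‖t‖ < r ∧ Sum.elim x (cexp ∘ x) = 𝔟[e, N, Φ₁, Φ₂, Φ₃, t] with hHit
  have hGne : G.Nonempty := Finset.card_pos.1 (by omega)
  obtain ⟨j₀, hj₀⟩ := hGne
  have hsub : {k : ℤ | ∀ j ∈ G, ∃ x ∈ indepExpPoints W, ∃ t : ℂ,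
        t = (x 0) ^ (-((e : ℂ)⁻¹)) ∧ x 0 = c + 2 * ↑Real.pi * I * ((k + j : ℤ) : ℂ) ∧
        0 < ‖t‖ ∧ ‖t‖ < r ∧ Sum.elim x (cexp ∘ x) = 𝔟[e, N, Φ₁, Φ₂, Φ₃, t]} ⊆
      (fun k => k + j₀) ⁻¹' {m | Hit m} := fun k hk => hk j₀ hj₀
  by_cases hfin : {m : ℤ | Hit m}.Finite
  · exact (hfin.preimage (add_left_injective j₀).injOn).subset hsub
  -- ### Case B: infinitely many coset hits on this branch
  have hinf : {m : ℤ | Hit m}.Infinite := hfin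
  obtain ⟨hΦ₁, hΦ₂, hΦ₃⟩ := hana 0 (by rw [norm_zero]; exact hr)
  -- (B0) small parameters: hits with large `x 0` have small `t`
  have hsmall : ∀ {x : Fin 2 → ℂ} {t : ℂ} {δ : ℝ}, 0 < δ → Sum.elim x (cexp ∘ x) = 𝔟[e, N, Φ₁, Φ₂, Φ₃, t] →
      0 < ‖t‖ → δ⁻¹ ^ e < ‖x 0‖ → ‖t‖ < δ := by
    intro x t δ hδ hxt ht hx0
    obtain ⟨h0, -, -, -⟩ := coords_of_eq_branch hxt
    rw [h0] at hx0
    exact norm_lt_of_inv_pow hδ (norm_pos_iff.1 ht) hx0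
  -- (B1) the coset hits accumulate at `t = 0`
  have hhitc : ∀ δ : ℝ, 0 < δ → Set.Infinite {x | x ∈ indepExpPoints W ∧
      (∃ m : ℤ, x 0 = c + 2 * ↑Real.pi * I * (m : ℂ)) ∧
      ∃ t : ℂ, 0 < ‖t‖ ∧ ‖t‖ < δ ∧ Sum.elim x (cexp ∘ x) = 𝔟[e, N, Φ₁, Φ₂, Φ₃, t]} := by
    intro δ hδ
    set S : Set ℤ := {m | Hit m} \ {m | ‖c + 2 * ↑Real.pi * I * (m : ℂ)‖ ≤ δ⁻¹ ^ e} with hS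
    have hSinf : S.Infinite := hinf.sdiff (finite_int_norm_coset_le c _)
    set pick : ℤ → (Fin 2 → ℂ) := fun m => if h : Hit m then h.choose else 0 with hpick
    have hpick : ∀ m, Hit m → pick m ∈ indepExpPoints W ∧ ∃ t : ℂ,
        t = (pick m 0) ^ (-((e : ℂ)⁻¹)) ∧ pick m 0 = c + 2 * ↑Real.pi * I * (m : ℂ) ∧
        0 < ‖t‖ ∧ ‖t‖ < r ∧ Sum.elim (pick m) (cexp ∘ pick m) = 𝔟[e, N, Φ₁, Φ₂, Φ₃, t] := by
      intro m hm
      have h := hm.choose_spec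
      simp only [hpick, dif_pos hm]
      exact ⟨h.1, h.2⟩
    refine Set.infinite_of_injOn_mapsTo (f := pick) ?_ ?_ hSinf
    · intro m hm m' hm' heq
      obtain ⟨-, t, -, h0, -⟩ := hpick m hm.1
      obtain ⟨-, t', -, h0', -⟩ := hpick m' hm'.1
      have : (c + 2 * ↑Real.pi * I * (m : ℂ)) = c + 2 * ↑Real.pi * I * (m' : ℂ) := by rw [← h0, ← h0', heq]
      have h2 : (m : ℂ) = (m' : ℂ) := by
        have hne : (2 * ↑Real.pi * I : ℂ) ≠ 0 := by simp [Real.pi_ne_zero, I_ne_zero]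
        exact mul_left_cancel₀ hne (by linear_combination this)
      exact_mod_cast h2
    · intro m hm
      obtain ⟨hxI, t, -, h0, ht0, htr, hxt⟩ := hpick m hm.1
      have hlt : δ⁻¹ ^ e < ‖pick m 0‖ := by
        rw [h0]; exact lt_of_not_ge hm.2
      exact ⟨hxI, ⟨m, h0⟩, t, ht0, hsmall hδ hxt ht0 hlt, hxt⟩
  -- (B2)–(B6) the phase of the branch
  obtain ⟨ℓ₁, hℓ₁, hy₁, hMan, hndeg⟩ := branch_phase_nondegenerate hW hdim he hr hana hWb c hhitc
  -- (B7) coset window rigidity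
  have hfinR := hrig e (N + 1) (fun t : ℂ => Φ₁ t / t ^ N - ℓ₁ t) c G he hMan hndeg (by omega)
  obtain ⟨δ₂, hδ₂, hδ₂P⟩ := exists_radius_of_eventually hy₁
  set Bad : Set ℤ := ⋃ j ∈ G, {k : ℤ | ‖c + 2 * ↑Real.pi * I * ((k + j : ℤ) : ℂ)‖ ≤ δ₂⁻¹ ^ e} with hBad
  have hBadfin : Bad.Finite := by
    refine Set.Finite.biUnion G.finite_toSet fun j _ => ?_
    exact (finite_int_norm_coset_le c (δ₂⁻¹ ^ e)).preimage (f := fun k : ℤ => k + j) (add_left_injective j).injOn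
  refine (hfinR.union hBadfin).subset ?_
  intro k hk
  by_cases hkB : k ∈ Bad
  · exact Or.inr hkB
  refine Or.inl fun j hj => ?_
  obtain ⟨x, -, t, htdef, hx0, ht0, -, hxt⟩ := hk j hj
  have hlarge : δ₂⁻¹ ^ e < ‖x 0‖ := by
    rw [hx0]
    by_contra hle
    exact hkB (Set.mem_iUnion₂.2 ⟨j, hj, not_lt.1 hle⟩)
  have htδ : ‖t‖ < δ₂ := hsmall hδ₂ hxt ht0 hlarge
  have hy := hδ₂P t ht0 htδ
  obtain ⟨-, h1, -, h3⟩ := coords_of_eq_branch hxt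
  have hexp : cexp (Φ₁ t / t ^ N) = cexp (ℓ₁ t) := by rw [← h1, h3, hy]
  obtain ⟨n, hn⟩ := Complex.exp_eq_exp_iff_exists_int.1 hexp
  refine ⟨n, ?_⟩
  rw [← hx0, ← htdef]
  show Φ₁ t / t ^ N - ℓ₁ t = (n : ℂ) * (2 * ↑Real.pi * I)
  rw [hn]; ring


end BranchLemma

/-- **Registered stub `stub_branchWindowFinite` (PROVED)** — explicit-binder form of `branch_window_finite`. [folklore] -/
theorem stub_branchWindowFinite : (∀ (e p : ℕ) (M : ℂ → ℂ) (c : ℂ) (G : Finset ℤ), 0 < e → AnalyticAt ℂ (fun t : ℂ => t ^ p * M t) 0 → (¬ ∃ Q : Polynomial ℂ, ∀ᶠ t in 𝓝[≠] (0 : ℂ), M t = Q.eval (t ^ e)⁻¹) → p + 2 ≤ G.card → Set.Finite {k : ℤ | ∀ j ∈ G, ∃ L : ℤ, M ((c + 2 * ↑Real.pi * Complex.I * ((k + j : ℤ) : ℂ)) ^ (-((e : ℂ)⁻¹))) = (L : ℂ) * (2 * ↑Real.pi * Complex.I)}) → ∀ (W : Set (Fin 2 ⊕ Fin 2 → ℂ))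 (e N : ℕ) (Φ₁ Φ₂ Φ₃ : ℂ → ℂ) (r : ℝ) (c : ℂ), Literature.NumberTheory.Transcendental.IsDefinedOver (⊥ : Subfield ℂ) W → Literature.NumberTheory.Transcendental.zariskiDim ℂ W < 2 → 0 < e → 0 < r → (∀ t : ℂ, ‖t‖ < r → AnalyticAt ℂ Φ₁ t ∧ AnalyticAt ℂ Φ₂ t ∧ AnalyticAt ℂ Φ₃ t) → (∀ t : ℂ, 0 < ‖t‖ → ‖t‖ < r → (Sum.elim ![(t ^ e)⁻¹, Φ₁ t / t ^ N] ![Φ₂ t / t ^ N, Φ₃ t / t ^ N] : Fin 2 ⊕ Fin 2 → ℂ) ∈ W) → ∃ L : ℕ, ∀ G : Finset ℤ, L ≤ G.card → Set.Finite {k : ℤ | ∀ j ∈ G, ∃ x ∈ Literature.NumberTheory.Transcendental.indepExpPoints W, ∃ t : ℂ, t = (x 0) ^ (-((e : ℂ)⁻¹)) ∧ x 0 = c + 2 * ↑Real.pi * Complex.I * ((k + j : ℤ) : ℂ) ∧ 0 < ‖t‖ ∧ ‖t‖ < r ∧ Sum.elim x (Complex.exp ∘ x) = (Sum.elim ![(t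 ^ e)⁻¹, Φ₁ t / t ^ N] ![Φ₂ t / t ^ N, Φ₃ t / t ^ N] : Fin 2 ⊕ Fin 2 → ℂ)} :=
  fun hrig _ _ _ _ _ _ _ c hW hdim he hr hana hWb => branch_window_finite hrig hW hdim he hr hana hWb c

end Summit.Schanuel.Schanuel.Cruxes.MinimalCounterexampleInAcl.KernelArithmeticSelection

end
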